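import Summits.QuantumFields.YangMills.Theorems.BalabanUVNodesN11NoExpansionGeneralStepLawsCoPH
import Summits.QuantumFields.YangMills.Theorems.BalabanUVNodesN11NoExpansionGeneralStepCoPHOldBranch

/-!
# DAG node N11 — THE NO-EXPANSION STEP AFTER AN ARBITRARY HISTORY AT THE v1.7 `CoPH` RECORD, LAW LEVEL, OLD-BRANCH FORM: this seat's `…NoExpansionGeneralStepLawsCoPH`
# (truncated carried witness ⇒ `Sect2.LawsT … k` ∧ 𝐓-clause at `s′`, and through 𝐑 `Sect2.LawsRT … (k+1)` ∧ post-𝐑 clause) with dag-n11-d's OLD-BRANCH step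
# `…NoExpansionGeneralStepCoPHOldBranch` — the consumer states measurability ∕ bound of the OLD branch `U ↦ 𝐓_k(init s′, S)[e^{A_k(init s′)}](U)` only

Cell `pub-ymgap`, YM-PLAN Track A (HUMAN RULING D-0062), seat `pub-ymgap-dag-n11-e` (g12; R134 fan-out row N11∕s3), route `BalabanUVNodes` rev 25 (v1.7 `CoPH` key), item
K1⁷ `StabilityBAtRecordR13SepCoPH` = stmt-QuantumFields-20542 (helper lane, count-neutral).  [III] = [Balaban1988Convergent], [IV] = [Balaban1989LargeFieldI].  Same proofs as
`…NoExpansionGeneralStepLawsCoPH` §2 (its header explains the truncated-witness device and the honest scope, which apply VERBATIM), with p544575's `hm` ∕ `hC` on the new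
integrand replaced by dag-n11-d's `hmB` ∕ `hCB` on the old branch (the hypothesis class of the accepted diagonal theorems).

WHAT THIS FILE PROVES (0 `sorry`, 0 `def`): ★ `exists_lawsT_clause_succ_CoPH_of_Omega_empty_of_oldBranch_of_lawsRT_of_clause` (clause-keyed 𝐓-side core: a witness `(t, E₀)` with
`Sect2.LawsRT … k` AND the clause at `init s′` ⇒ `∃ t₀`, `Sect2.LawsT … k` AND the 𝐓-image clause at `s′`, same constant) · ★
`exists_lawsRT_slotClause_succ_CoPH_of_Omega_empty_of_oldBranch_of_lawsRT_of_clause_of_liveSel` (its reading through 𝐑: `Sect2.LawsRT … (k+1)` ∧ post-𝐑 clause) · ★★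
`exists_lawsT_clause_succ_CoPH_of_Omega_empty_of_sLaw₁₃CoPH_of_oldBranch` · ★★ `exists_lawsRT_slotClause_succ_CoPH_of_Omega_empty_of_sLaw₁₃CoPH_of_oldBranch_of_liveSel` (keyed on
`SLaw₁₃CoPH θ p k`: Theorem 1's inductive step on the no-expansion branch after any history, LAWS INCLUDED, at one sequence, with the consumer's obligations = (P)∕(V)∕`hqloc`∕`hA`
on the witness + `hmB`∕`hCB` on the old branch).

HONEST FRAMING.  Count-neutral kernel bookkeeping; binders DISPLAYED exactly as in dag-n11-d's old-branch file; NOT `TLaw₁₃CoPH θ p k` ∕ NOT `SLaw₁₃CoPH θ p (k+1)` (all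
new sequences incl. `Ω_{k+1} ≠ ∅` = [III] Sect. 1 ∕ §3 ∕ Thm 2 proper + a universal-𝐄 witness family); nothing of Bałaban asserted; N11 NOT discharged; K1⁷ NOT closed; counts
unmoved (typed 28∕28 · discharged 5∕27).  One finite `𝕋⁴_{L^K}` programme at fixed `ε = L^{−K}`; NOT ℝ⁴ ∕ OS ∕ mass-gap ∕ Clay.
Sources: [III] Thm 1 p.262, §2 p.262, Theorem p.245, (2.17)–(2.18) p.257, (2.23)–(2.31) pp.258–260, (2.40)–(2.42) p.261, (3.16) p.268, (3.24)–(3.25) p.270; [IV] (0.2)–(0.4)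
p.176, p.177 (i)–(ii); [Balaban1987RG1] (0.20) p.256.
-/

noncomputable section

open MeasureTheory
open scoped BigOperators Matrix.Norms.L2Operator

namespace Summit.QuantumFields.YangMills.Theorems.BalabanUVNodesN11NoExpansionGeneralStepLawsCoPHOldBranch

open Literature.MathematicalPhysics.QuantumFieldTheory.Balaban1983to89 T4Continuum Node00 Node00.Tk DagBinding
open Literature.MathematicalPhysics.QuantumFieldTheory.Balaban1983to89.B16RLeafRecord13LiveGenericZS
open BalabanUVNodesN11NoExpansionTruncatedWitness (lawsT_towerOfTerms_of_lawsRT_of_agree_of_vanish sect2Slot_succ_congr_of_agree_of_Omega_empty)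
open BalabanUVNodesN11NoExpansionGeneralStepLawsCoPH (sect2TowerOfRecord_rzAt_succ_eq_init_of_Omega_empty)
open BalabanUVNodesN11NoExpansionGeneralStepCoPHOldBranch (clause_succ_CoPH_of_Omega_empty_of_pinChi_of_oldBranch_of_clause)

variable {F : T4Family} {N : ℕ} [NeZero N]

section LawsOldBranch

variable (θ : Stage13HParams F N) (p : B12.RunParams)

/-- **★ THE 𝐓-SIDE OF THE NO-EXPANSION STEP AFTER ANY HISTORY, LAW + CLAUSE, CLAUSE-KEYED, OLD-BRANCH FORM** (`hmB` ∕ `hCB` on the OLD branch `U ↦ 𝐓_k(init s′, S)[e^{A_k(init s′)}](U)` in place of p544575's `hm` ∕ `hC`; dag-n11-d's `clause_succ_CoPH_of_Omega_empty_of_pinChi_of_oldBranch_of_clause`) — (generic `θ : Stage13HParams`, v1.7 core provisos, `k < K`, `1 ≤ M`,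
`0 ≤ E₀, B₀`): a witness `(t, E₀)` carrying at `init s′` BOTH the inductive assumptions `Sect2.LawsRT (sect2TowerOfRecord … (θ.rzAt p (init s′)) (init s′) t) lf k` AND the
level-`k` clause `hid`, at a new sequence `s′` with `Ω_{k+1}(s′) = ∅` (ANY history), under dag-n11-d's displayed data for that witness VERBATIM (`hqloc`, (P) `hpre`, `hA`, (V)
`hZ` + `hq`, `hm` ∕ `hC` — p544575 `clause_succ_CoPH_of_Omega_empty_of_pinChi_of_provisos_of_clause`), yields term values `t₀` with (i) the 𝐓-image LAW PACKAGE
`Sect2.LawsT (sect2TowerOfRecord … (θ.rzAt p s′) s′ t₀) lf βc k` AND (ii) the 𝐓-image clause of `slotT_{k+1}(s′)` at `(t₀, E₀)` (same constant).  Witness: `t` TRUNCATED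
above level `k`; (i) by §0 through `sect2TowerOfRecord_rzAt_succ_eq_init_of_Omega_empty`, the run's RG equation (`settingOfRecord₁₃_satisfiesRG`) and `0 ≤ g_{k+1}`
(`gOfRecord₁₃_succ_nonneg`); (ii) is dag-n11-d's clause for `t` read through §1. [cite: Balaban1988Convergent, Thm 1 p.262, §2 p.262, Theorem p.245, (3.24)–(3.25) p.270, (2.23)–(2.31) pp.258–260, (2.40)–(2.42) p.261; Balaban1989LargeFieldI, (0.2)–(0.3) p.176; Balaban1987RG1, (0.20) p.256] -/
theorem exists_lawsT_clause_succ_CoPH_of_Omega_empty_of_oldBranch_of_lawsRT_of_clause (h : θ.Provisos₁₃CoPH F N) {k : ℕ} (hk : k < p.K) (hM : 1 ≤ θ.τ9.M)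
    (hE₀ : 0 ≤ θ.s2.lf.E₀) (hB₀ : 0 ≤ θ.s2.lf.B₀)
    (s : SeqOfRecord F θ.ν θ.τ9.M (gOfRecord₁₃ F N θ.toStage13Params p) p.K (k + 1)) (hΩ : s.Ω (k + 1) = ∅)
    (hqloc : ∀ j, j < k → ∀ ω ω' : MultiCfg (F.P p.K) (SU N) (FluctV N), (∀ i, i ≤ k → ω i = ω' i) →
      (θ.zhAt p s).quad j (s.init.Λ (j + 1)) ω = (θ.zhAt p s).quad j (s.init.Λ (j + 1)) ω')
    (hpre : ∀ j, j < k → (θ.zhAt p s).ζ0 j = (θ.zhAt p s.init).ζ0 j ∧ (θ.zhAt p s).quad j = (θ.zhAt p s.init).quad j)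
    (t : Sect2.TermValues (F.P p.K) (MatA N) (FluctV N) θ.τ9.M) (E₀ : ℝ)
    (hA : ∀ (S : ℕ → Set (Site (F.P p.K) 0)) (a a' : Tk.MSFluct (F.P p.K) (FluctV N)) (Uf : GaugeField (F.P p.K) 0 (SU N)), (∀ i, i ≤ k → a i = a' i) →
      (sect2ActionDataOfRecord F N (FluctV N) p.K (settingOfRecord₁₃ F N θ.toStage13Params p) (θ.rzAt p s.init) s.init t (S, a) E₀).action23 k Uf =
        (sect2ActionDataOfRecord F N (FluctV N) p.K (settingOfRecord₁₃ F N θ.toStage13Params p) (θ.rzAt p s.init) s.init t (S, a') E₀).action23 k Uf)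
    (hlaw : Sect2.LawsRT (sect2TowerOfRecord F N (FluctV N) p.K (settingOfRecord₁₃ F N θ.toStage13Params p) (θ.rzAt p s.init) s.init t)
      (settingOfRecord₁₃ F N θ.toStage13Params p).lf k)
    (hid : slotsOfRecord F N θ.ν θ.τ9 (EOfRecord₁₃ F N θ.toStage13Params) (wOfRecord₉ F N θ.toStage9Params) θ.ppSel p
        (gOfRecord₁₃ F N θ.toStage13Params p) k s.init = 0 ∨
      ∀ᵐ U₀ ∂fieldMeasure (F.P p.K) k (SU N),
        chiSeqOfRecord F N θ.ν θ.τ9.M (gOfRecord₁₃ F N θ.toStage13Params p) p.K k s.init U₀ ≠ 0 →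
          slotsOfRecord F N θ.ν θ.τ9 (EOfRecord₁₃ F N θ.toStage13Params) (wOfRecord₉ F N θ.toStage9Params) θ.ppSel p
              (gOfRecord₁₃ F N θ.toStage13Params p) k s.init U₀ =
            sect2Slot F N (FluctV N) p.K (settingOfRecord₁₃ F N θ.toStage13Params p) (θ.rzAt p s.init) (WtOfRecord₁₃H F N θ p s.init) s.init t E₀
              (UbgOfRecord₁₃CoP F N θ.toStage13Params p k s.init) U₀)
    (hZ : ∀ (V' : GaugeField (F.P p.K) (k + 1) (SU N)) (U₀ : GaugeField (F.P p.K) k (SU N)),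
      (θ.zhAt p s).ζ0 k Set.univ (pairCfgAt (V := FluctV N) k V' U₀) =
        chiSeqOfRecord F N θ.ν θ.τ9.M (gOfRecord₁₃ F N θ.toStage13Params p) p.K k s.init U₀ *
          wOfRecord₉ F N θ.toStage9Params p (gOfRecord₁₃ F N θ.toStage13Params p) k s U₀ ((avOfRecord F N p.K k).avg U₀))
    (hq : ∀ (V' : GaugeField (F.P p.K) (k + 1) (SU N)) (U₀ : GaugeField (F.P p.K) k (SU N)), (θ.zhAt p s).quad k ∅ (pairCfgAt (V := FluctV N) k V' U₀) = 0)
    {C : ℝ}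
    (hmB : ∀ S ∈ admSOfRecord F θ.ν θ.τ9.M (gOfRecord₁₃ F N θ.toStage13Params p) p.K k s.init,
      Measurable fun U₀ : GaugeField (F.P p.K) k (SU N) =>
        tkBranchOfRecord F N (FluctV N) θ.ν θ.τ9.M _ p.K (WtOfRecord₁₃H F N θ p s) s.init S k
          (fun ω => sect2Operand F N (FluctV N) p.K (settingOfRecord₁₃ F N θ.toStage13Params p) (θ.rzAt p s.init) s.init t E₀
            (UbgOfRecord₁₃CoP F N θ.toStage13Params p k s.init) (S, fun j => (ω j).2) (fun j => (ω j).1))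
          (baseCfg (V := FluctV N) k U₀))
    (hCB : ∀ S ∈ admSOfRecord F θ.ν θ.τ9.M (gOfRecord₁₃ F N θ.toStage13Params p) p.K k s.init, ∀ U₀ : GaugeField (F.P p.K) k (SU N),
      |tkBranchOfRecord F N (FluctV N) θ.ν θ.τ9.M _ p.K (WtOfRecord₁₃H F N θ p s) s.init S k
          (fun ω => sect2Operand F N (FluctV N) p.K (settingOfRecord₁₃ F N θ.toStage13Params p) (θ.rzAt p s.init) s.init t E₀
            (UbgOfRecord₁₃CoP F N θ.toStage13Params p k s.init) (S, fun j => (ω j).2) (fun j => (ω j).1))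
          (baseCfg (V := FluctV N) k U₀)| ≤ C) :
    ∃ t₀ : Sect2.TermValues (F.P p.K) (MatA N) (FluctV N) θ.τ9.M,
      Sect2.LawsT (sect2TowerOfRecord F N (FluctV N) p.K (settingOfRecord₁₃ F N θ.toStage13Params p) (θ.rzAt p s) s t₀)
          (settingOfRecord₁₃ F N θ.toStage13Params p).lf (settingOfRecord₁₃ F N θ.toStage13Params p).βc k ∧
        (slotsTOfRecord F N θ.ν θ.τ9 (EOfRecord₁₃ F N θ.toStage13Params) (wOfRecord₉ F N θ.toStage9Params) θ.ppSel p
            (gOfRecord₁₃ F N θ.toStage13Params p) (k + 1) s = 0 ∨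
          ∀ᵐ V' ∂fieldMeasure (F.P p.K) (k + 1) (SU N),
            chiSeqOfRecord F N θ.ν θ.τ9.M (gOfRecord₁₃ F N θ.toStage13Params p) p.K (k + 1) s V' ≠ 0 →
              slotsTOfRecord F N θ.ν θ.τ9 (EOfRecord₁₃ F N θ.toStage13Params) (wOfRecord₉ F N θ.toStage9Params) θ.ppSel p
                  (gOfRecord₁₃ F N θ.toStage13Params p) (k + 1) s V' =
                sect2Slot F N (FluctV N) p.K (settingOfRecord₁₃ F N θ.toStage13Params p) (θ.rzAt p s) (WtOfRecord₁₃H F N θ p s) s t₀ E₀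
                  (UbgOfRecord₁₃CoP F N θ.toStage13Params p (k + 1) s) V') := by
  -- the carried witness `t` TRUNCATED above level `k` (print: no new terms at a no-expansion step)
  let t' : Sect2.TermValues (F.P p.K) (MatA N) (FluctV N) θ.τ9.M :=
    ⟨fun j X z gc φ => if j ≤ k then t.E j X z gc φ else 0, fun j X φ => if j ≤ k then t.R j X φ else 0,
      fun j X φ a => if j ≤ k then t.B j X φ a else 0⟩
  have hE : ∀ j, j ≤ k → ∀ X z gc φ, t'.E j X z gc φ = t.E j X z gc φ := fun j hj X z gc φ => if_pos hj
  have hR : ∀ j, j ≤ k → ∀ X φ, t'.R j X φ = t.R j X φ := fun j hj X φ => if_pos hj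
  have hB : ∀ j, j ≤ k → ∀ X φ a, t'.B j X φ a = t.B j X φ a := fun j hj X φ a => if_pos hj
  have hE' : ∀ X z gc φ, t'.E (k + 1) X z gc φ = 0 := fun X z gc φ => if_neg (Nat.not_succ_le_self k)
  have hR' : ∀ X φ, t'.R (k + 1) X φ = 0 := fun X φ => if_neg (Nat.not_succ_le_self k)
  have hB' : ∀ X φ a, t'.B (k + 1) X φ a = 0 := fun X φ a => if_neg (Nat.not_succ_le_self k)
  refine ⟨t', ?_, ?_⟩
  · -- (i) the law package of the 𝐓-image at `s′` for the truncated witness: old levels from the laws at `init s′`, level `k+1` absent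
    rw [sect2TowerOfRecord_rzAt_succ_eq_init_of_Omega_empty θ p s hΩ]
    exact lawsT_towerOfTerms_of_lawsRT_of_agree_of_vanish _ _ _ hE hR hB hE' hR' hB' hlaw
      (settingOfRecord₁₃_satisfiesRG F N θ.toStage13Params p (k + 1) k (Nat.lt_succ_self k)) hE₀ hB₀
      (B16RLeafRecord13Live.gOfRecord₁₃_succ_nonneg F N θ.toStage13Params p k)
  · -- (ii) the clause: dag-n11-d's 𝐓-step for `t`; the slot at `s′` does not read the witness above level `k`
    rw [sect2Slot_succ_congr_of_agree_of_Omega_empty (FluctV N) _ _ _ hM s hΩ hE hR hB]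
    exact clause_succ_CoPH_of_Omega_empty_of_pinChi_of_oldBranch_of_clause θ p h hk hM s hΩ hqloc hpre t E₀ hA hid hZ hq hmB hCB

/-- **★★ THE 𝐓-SIDE OF THE NO-EXPANSION STEP AFTER ANY HISTORY, LAW + CLAUSE, OLD-BRANCH FORM, from `SLaw₁₃CoPH θ p k`.**  For `θ : Stage13HParams` with the v1.7 core provisos, `k < K`, `1 ≤ M`,
`0 ≤ E₀, B₀`, the §2 form of `ρ_k`, a new sequence `s′` with `Ω_{k+1}(s′) = ∅` after ANY history, and dag-n11-d's displayed data at `s′` VERBATIM (`hqloc`, (P) `hpre`, `hA`, (V)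
`hZ` + `hq`, `hm` ∕ `hC` for every `(t₀, E₀)` — p544575 `exists_clause_succ_CoPH_of_Omega_empty_of_sLaw₁₃CoPH`): THERE ARE term values `t₀` and a constant `E′` such that
(i) `Sect2.LawsT (sect2TowerOfRecord … (θ.rzAt p s′) s′ t₀) lf βc k` — the LAW PACKAGE of the 𝐓-image at `s′` — AND (ii) the 𝐓-image clause «`slotT_{k+1}(s′) = 0 ∨ slotT_{k+1}(s′)
= 𝐓_{k+1}(s′) e^{A_{k+1}(s′)}` at `(t₀, E′)` a.e. on `supp χ_{k+1}(s′)`»; i.e. the complete `s′`-conjunct of node00-def-T's `HasSect2FormTAEZS`.  Witness: `SLaw_k`'s `t (init s′)`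
TRUNCATED above level `k` (zero `𝐄^{(j)}, 𝐑^{(j)}, 𝐁^{(j)}` for `j > k`), `E′ = E_k(init s′)`; (i) by §0 from `SLaw_k`'s laws at `init s′` through
`sect2TowerOfRecord_rzAt_succ_eq_init_of_Omega_empty`, the run's RG equation (`settingOfRecord₁₃_satisfiesRG`) and `0 ≤ g_{k+1}` (`gOfRecord₁₃_succ_nonneg`); (ii) is dag-n11-d's
clause for `t (init s′)` read through §1 (the slot at `s′` does not see the truncation). [cite: Balaban1988Convergent, Thm 1 p.262, §2 p.262, Theorem p.245, (3.24)–(3.25) p.270, (2.23)–(2.31) pp.258–260, (2.40)–(2.42) p.261; Balaban1989LargeFieldI, (0.2)–(0.3) p.176; Balaban1987RG1, (0.20) p.256] -/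
theorem exists_lawsT_clause_succ_CoPH_of_Omega_empty_of_sLaw₁₃CoPH_of_oldBranch (h : θ.Provisos₁₃CoPH F N) {k : ℕ} (hk : k < p.K) (hM : 1 ≤ θ.τ9.M)
    (hE₀ : 0 ≤ θ.s2.lf.E₀) (hB₀ : 0 ≤ θ.s2.lf.B₀) (hS : SLaw₁₃CoPH F N θ p k)
    (s : SeqOfRecord F θ.ν θ.τ9.M (gOfRecord₁₃ F N θ.toStage13Params p) p.K (k + 1)) (hΩ : s.Ω (k + 1) = ∅)
    (hqloc : ∀ j, j < k → ∀ ω ω' : MultiCfg (F.P p.K) (SU N) (FluctV N), (∀ i, i ≤ k → ω i = ω' i) →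
      (θ.zhAt p s).quad j (s.init.Λ (j + 1)) ω = (θ.zhAt p s).quad j (s.init.Λ (j + 1)) ω')
    (hpre : ∀ j, j < k → (θ.zhAt p s).ζ0 j = (θ.zhAt p s.init).ζ0 j ∧ (θ.zhAt p s).quad j = (θ.zhAt p s.init).quad j)
    (hA : ∀ (t₀ : Sect2.TermValues (F.P p.K) (MatA N) (FluctV N) θ.τ9.M) (E₀ : ℝ) (S : ℕ → Set (Site (F.P p.K) 0))
      (a a' : Tk.MSFluct (F.P p.K) (FluctV N)) (Uf : GaugeField (F.P p.K) 0 (SU N)), (∀ i, i ≤ k → a i = a' i) →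
      (sect2ActionDataOfRecord F N (FluctV N) p.K (settingOfRecord₁₃ F N θ.toStage13Params p) (θ.rzAt p s.init) s.init t₀ (S, a) E₀).action23 k Uf =
        (sect2ActionDataOfRecord F N (FluctV N) p.K (settingOfRecord₁₃ F N θ.toStage13Params p) (θ.rzAt p s.init) s.init t₀ (S, a') E₀).action23 k Uf)
    (hZ : ∀ (V' : GaugeField (F.P p.K) (k + 1) (SU N)) (U₀ : GaugeField (F.P p.K) k (SU N)),
      (θ.zhAt p s).ζ0 k Set.univ (pairCfgAt (V := FluctV N) k V' U₀) =
        chiSeqOfRecord F N θ.ν θ.τ9.M (gOfRecord₁₃ F N θ.toStage13Params p) p.K k s.init U₀ *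
          wOfRecord₉ F N θ.toStage9Params p (gOfRecord₁₃ F N θ.toStage13Params p) k s U₀ ((avOfRecord F N p.K k).avg U₀))
    (hq : ∀ (V' : GaugeField (F.P p.K) (k + 1) (SU N)) (U₀ : GaugeField (F.P p.K) k (SU N)), (θ.zhAt p s).quad k ∅ (pairCfgAt (V := FluctV N) k V' U₀) = 0)
    {C : ℝ}
    (hmB : ∀ (t₀ : Sect2.TermValues (F.P p.K) (MatA N) (FluctV N) θ.τ9.M) (E₀ : ℝ),
      ∀ S ∈ admSOfRecord F θ.ν θ.τ9.M (gOfRecord₁₃ F N θ.toStage13Params p) p.K k s.init,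
      Measurable fun U₀ : GaugeField (F.P p.K) k (SU N) =>
        tkBranchOfRecord F N (FluctV N) θ.ν θ.τ9.M _ p.K (WtOfRecord₁₃H F N θ p s) s.init S k
          (fun ω => sect2Operand F N (FluctV N) p.K (settingOfRecord₁₃ F N θ.toStage13Params p) (θ.rzAt p s.init) s.init t₀ E₀
            (UbgOfRecord₁₃CoP F N θ.toStage13Params p k s.init) (S, fun j => (ω j).2) (fun j => (ω j).1))
          (baseCfg (V := FluctV N) k U₀))
    (hCB : ∀ (t₀ : Sect2.TermValues (F.P p.K) (MatA N) (FluctV N) θ.τ9.M) (E₀ : ℝ),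
      ∀ S ∈ admSOfRecord F θ.ν θ.τ9.M (gOfRecord₁₃ F N θ.toStage13Params p) p.K k s.init, ∀ U₀ : GaugeField (F.P p.K) k (SU N),
      |tkBranchOfRecord F N (FluctV N) θ.ν θ.τ9.M _ p.K (WtOfRecord₁₃H F N θ p s) s.init S k
          (fun ω => sect2Operand F N (FluctV N) p.K (settingOfRecord₁₃ F N θ.toStage13Params p) (θ.rzAt p s.init) s.init t₀ E₀
            (UbgOfRecord₁₃CoP F N θ.toStage13Params p k s.init) (S, fun j => (ω j).2) (fun j => (ω j).1))
          (baseCfg (V := FluctV N) k U₀)| ≤ C) :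
    ∃ (t₀ : Sect2.TermValues (F.P p.K) (MatA N) (FluctV N) θ.τ9.M) (E' : ℝ),
      Sect2.LawsT (sect2TowerOfRecord F N (FluctV N) p.K (settingOfRecord₁₃ F N θ.toStage13Params p) (θ.rzAt p s) s t₀)
          (settingOfRecord₁₃ F N θ.toStage13Params p).lf (settingOfRecord₁₃ F N θ.toStage13Params p).βc k ∧
        (slotsTOfRecord F N θ.ν θ.τ9 (EOfRecord₁₃ F N θ.toStage13Params) (wOfRecord₉ F N θ.toStage9Params) θ.ppSel p
            (gOfRecord₁₃ F N θ.toStage13Params p) (k + 1) s = 0 ∨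
          ∀ᵐ V' ∂fieldMeasure (F.P p.K) (k + 1) (SU N),
            chiSeqOfRecord F N θ.ν θ.τ9.M (gOfRecord₁₃ F N θ.toStage13Params p) p.K (k + 1) s V' ≠ 0 →
              slotsTOfRecord F N θ.ν θ.τ9 (EOfRecord₁₃ F N θ.toStage13Params) (wOfRecord₉ F N θ.toStage9Params) θ.ppSel p
                  (gOfRecord₁₃ F N θ.toStage13Params p) (k + 1) s V' =
                sect2Slot F N (FluctV N) p.K (settingOfRecord₁₃ F N θ.toStage13Params p) (θ.rzAt p s) (WtOfRecord₁₃H F N θ p s) s t₀ E'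
                  (UbgOfRecord₁₃CoP F N θ.toStage13Params p (k + 1) s) V') := by
  obtain ⟨t, Ek, -, hs⟩ := (sLaw₁₃CoPH_iff F N θ p k).1 hS
  obtain ⟨t₀, hlaw, hcl⟩ := exists_lawsT_clause_succ_CoPH_of_Omega_empty_of_oldBranch_of_lawsRT_of_clause θ p h hk hM hE₀ hB₀ s hΩ hqloc hpre (t s.init) (Ek s.init)
    (hA _ _) (hs s.init).1 (hs s.init).2 hZ hq (hmB _ _) (hCB _ _)
  exact ⟨t₀, Ek s.init, hlaw, hcl⟩

/-- **★ … READ THROUGH 𝐑 ON THE LIVE-SELECTOR LINE, CLAUSE-KEYED, OLD-BRANCH FORM**: the same witness-carrying step under node00-def-T's selector clause, admissibility and `0 ≤ κ` in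
addition gives `t₀` with `Sect2.LawsRT (sect2TowerOfRecord … (θ.rzAt p s′) s′ t₀) lf (k+1)` (11c's `LawsT.toRT_succ`; `0 ≤ β` from admissibility, `0 ≤ g_{k+1}` free) AND the
post-𝐑 §2 dichotomy of `ρ_{k+1}`'s slot at `s′` at `(t₀, E₀)` (this seat's `slotClauseΦ_succ_of_slotTClauseΦ_of_liveSel_of_rstep` from row `rstep`) — the complete `s′`-conjunct
of the §2 form of `ρ_{k+1}` from the `init s′`-conjunct of the §2 form of `ρ_k`, along a no-expansion step after any history. [cite: Balaban1988Convergent, Thm 1 p.262, §2 p.262, Theorem p.245, (3.24)–(3.25) p.270, (2.17)–(2.18) p.257, p.279; Balaban1989LargeFieldI, (0.2)–(0.4) p.176, p.177 (i)–(ii)] -/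
theorem exists_lawsRT_slotClause_succ_CoPH_of_Omega_empty_of_oldBranch_of_lawsRT_of_clause_of_liveSel (h : θ.Provisos₁₃CoPH F N)
    (hsel : θ.ppSel = ppSelLiveOfRecord F N θ.ν θ.τ9 (EOfRecord₁₃ F N θ.toStage13Params) (wOfRecord₉ F N θ.toStage9Params))
    (hθ : θ.Admissible F N) (hκ : 0 ≤ θ.s2.lf.κ) (hE₀ : 0 ≤ θ.s2.lf.E₀) (hB₀ : 0 ≤ θ.s2.lf.B₀)
    {k : ℕ} (hk : k < p.K) (hM : 1 ≤ θ.τ9.M)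
    (s : SeqOfRecord F θ.ν θ.τ9.M (gOfRecord₁₃ F N θ.toStage13Params p) p.K (k + 1)) (hΩ : s.Ω (k + 1) = ∅)
    (hqloc : ∀ j, j < k → ∀ ω ω' : MultiCfg (F.P p.K) (SU N) (FluctV N), (∀ i, i ≤ k → ω i = ω' i) →
      (θ.zhAt p s).quad j (s.init.Λ (j + 1)) ω = (θ.zhAt p s).quad j (s.init.Λ (j + 1)) ω')
    (hpre : ∀ j, j < k → (θ.zhAt p s).ζ0 j = (θ.zhAt p s.init).ζ0 j ∧ (θ.zhAt p s).quad j = (θ.zhAt p s.init).quad j)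
    (t : Sect2.TermValues (F.P p.K) (MatA N) (FluctV N) θ.τ9.M) (E₀ : ℝ)
    (hA : ∀ (S : ℕ → Set (Site (F.P p.K) 0)) (a a' : Tk.MSFluct (F.P p.K) (FluctV N)) (Uf : GaugeField (F.P p.K) 0 (SU N)), (∀ i, i ≤ k → a i = a' i) →
      (sect2ActionDataOfRecord F N (FluctV N) p.K (settingOfRecord₁₃ F N θ.toStage13Params p) (θ.rzAt p s.init) s.init t (S, a) E₀).action23 k Uf =
        (sect2ActionDataOfRecord F N (FluctV N) p.K (settingOfRecord₁₃ F N θ.toStage13Params p) (θ.rzAt p s.init) s.init t (S, a') E₀).action23 k Uf)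
    (hlaw : Sect2.LawsRT (sect2TowerOfRecord F N (FluctV N) p.K (settingOfRecord₁₃ F N θ.toStage13Params p) (θ.rzAt p s.init) s.init t)
      (settingOfRecord₁₃ F N θ.toStage13Params p).lf k)
    (hid : slotsOfRecord F N θ.ν θ.τ9 (EOfRecord₁₃ F N θ.toStage13Params) (wOfRecord₉ F N θ.toStage9Params) θ.ppSel p
        (gOfRecord₁₃ F N θ.toStage13Params p) k s.init = 0 ∨
      ∀ᵐ U₀ ∂fieldMeasure (F.P p.K) k (SU N),
        chiSeqOfRecord F N θ.ν θ.τ9.M (gOfRecord₁₃ F N θ.toStage13Params p) p.K k s.init U₀ ≠ 0 →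
          slotsOfRecord F N θ.ν θ.τ9 (EOfRecord₁₃ F N θ.toStage13Params) (wOfRecord₉ F N θ.toStage9Params) θ.ppSel p
              (gOfRecord₁₃ F N θ.toStage13Params p) k s.init U₀ =
            sect2Slot F N (FluctV N) p.K (settingOfRecord₁₃ F N θ.toStage13Params p) (θ.rzAt p s.init) (WtOfRecord₁₃H F N θ p s.init) s.init t E₀
              (UbgOfRecord₁₃CoP F N θ.toStage13Params p k s.init) U₀)
    (hZ : ∀ (V' : GaugeField (F.P p.K) (k + 1) (SU N)) (U₀ : GaugeField (F.P p.K) k (SU N)),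
      (θ.zhAt p s).ζ0 k Set.univ (pairCfgAt (V := FluctV N) k V' U₀) =
        chiSeqOfRecord F N θ.ν θ.τ9.M (gOfRecord₁₃ F N θ.toStage13Params p) p.K k s.init U₀ *
          wOfRecord₉ F N θ.toStage9Params p (gOfRecord₁₃ F N θ.toStage13Params p) k s U₀ ((avOfRecord F N p.K k).avg U₀))
    (hq : ∀ (V' : GaugeField (F.P p.K) (k + 1) (SU N)) (U₀ : GaugeField (F.P p.K) k (SU N)), (θ.zhAt p s).quad k ∅ (pairCfgAt (V := FluctV N) k V' U₀) = 0)
    {C : ℝ}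
    (hmB : ∀ S ∈ admSOfRecord F θ.ν θ.τ9.M (gOfRecord₁₃ F N θ.toStage13Params p) p.K k s.init,
      Measurable fun U₀ : GaugeField (F.P p.K) k (SU N) =>
        tkBranchOfRecord F N (FluctV N) θ.ν θ.τ9.M _ p.K (WtOfRecord₁₃H F N θ p s) s.init S k
          (fun ω => sect2Operand F N (FluctV N) p.K (settingOfRecord₁₃ F N θ.toStage13Params p) (θ.rzAt p s.init) s.init t E₀
            (UbgOfRecord₁₃CoP F N θ.toStage13Params p k s.init) (S, fun j => (ω j).2) (fun j => (ω j).1))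
          (baseCfg (V := FluctV N) k U₀))
    (hCB : ∀ S ∈ admSOfRecord F θ.ν θ.τ9.M (gOfRecord₁₃ F N θ.toStage13Params p) p.K k s.init, ∀ U₀ : GaugeField (F.P p.K) k (SU N),
      |tkBranchOfRecord F N (FluctV N) θ.ν θ.τ9.M _ p.K (WtOfRecord₁₃H F N θ p s) s.init S k
          (fun ω => sect2Operand F N (FluctV N) p.K (settingOfRecord₁₃ F N θ.toStage13Params p) (θ.rzAt p s.init) s.init t E₀
            (UbgOfRecord₁₃CoP F N θ.toStage13Params p k s.init) (S, fun j => (ω j).2) (fun j => (ω j).1))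
          (baseCfg (V := FluctV N) k U₀)| ≤ C) :
    ∃ t₀ : Sect2.TermValues (F.P p.K) (MatA N) (FluctV N) θ.τ9.M,
      Sect2.LawsRT (sect2TowerOfRecord F N (FluctV N) p.K (settingOfRecord₁₃ F N θ.toStage13Params p) (θ.rzAt p s) s t₀)
          (settingOfRecord₁₃ F N θ.toStage13Params p).lf (k + 1) ∧
        (slotsOfRecord F N θ.ν θ.τ9 (EOfRecord₁₃ F N θ.toStage13Params) (wOfRecord₉ F N θ.toStage9Params) θ.ppSel p
            (gOfRecord₁₃ F N θ.toStage13Params p) (k + 1) s = 0 ∨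
          ∀ᵐ V' ∂fieldMeasure (F.P p.K) (k + 1) (SU N),
            chiSeqOfRecord F N θ.ν θ.τ9.M (gOfRecord₁₃ F N θ.toStage13Params p) p.K (k + 1) s V' ≠ 0 →
              slotsOfRecord F N θ.ν θ.τ9 (EOfRecord₁₃ F N θ.toStage13Params) (wOfRecord₉ F N θ.toStage9Params) θ.ppSel p
                  (gOfRecord₁₃ F N θ.toStage13Params p) (k + 1) s V' =
                sect2Slot F N (FluctV N) p.K (settingOfRecord₁₃ F N θ.toStage13Params p) (θ.rzAt p s) (WtOfRecord₁₃H F N θ p s) s t₀ E₀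
                  (UbgOfRecord₁₃CoP F N θ.toStage13Params p (k + 1) s) V') := by
  obtain ⟨t₀, hlawT, hcl⟩ := exists_lawsT_clause_succ_CoPH_of_Omega_empty_of_oldBranch_of_lawsRT_of_clause θ p h hk hM hE₀ hB₀ s hΩ hqloc hpre t E₀ hA hlaw hid hZ hq hmB hCB
  exact ⟨t₀, hlawT.toRT_succ hθ.toStage12.pos.2.1 hκ hE₀ hB₀ (B16RLeafRecord13Live.gOfRecord₁₃_succ_nonneg F N θ.toStage13Params p k),
    slotClauseΦ_succ_of_slotTClauseΦ_of_liveSel_of_rstep F N θ.toStage13Params p (fun q j _ hj => h.rstep q j hj) hsel k hk s _ fun _ => hcl⟩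

/-- **★★ … READ THROUGH 𝐑 ON THE LIVE-SELECTOR LINE, OLD-BRANCH FORM: THE COMPLETE `s′`-CONJUNCT OF THE §2 FORM OF `ρ_{k+1}`** — under node00-def-T's selector clause, admissibility and `0 ≤ κ`
in addition: THERE ARE `t₀`, `E′` with `Sect2.LawsRT (sect2TowerOfRecord … (θ.rzAt p s′) s′ t₀) lf (k+1)` (11c's `LawsT.toRT_succ` under the signs; `0 ≤ β` from admissibility,
`0 ≤ g_{k+1}` free) AND the post-𝐑 §2 dichotomy of `ρ_{k+1}`'s slot at `s′` at `(t₀, E′)` (this seat's `slotClauseΦ_succ_of_slotTClauseΦ_of_liveSel_of_rstep` from row `rstep`)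
— Theorem 1's inductive step on the no-expansion branch after any history, laws included, at ONE sequence. [cite: Balaban1988Convergent, Thm 1 p.262, §2 p.262, Theorem p.245, (3.24)–(3.25) p.270, (2.17)–(2.18) p.257, p.279; Balaban1989LargeFieldI, (0.2)–(0.4) p.176, p.177 (i)–(ii)] -/
theorem exists_lawsRT_slotClause_succ_CoPH_of_Omega_empty_of_sLaw₁₃CoPH_of_oldBranch_of_liveSel (h : θ.Provisos₁₃CoPH F N)
    (hsel : θ.ppSel = ppSelLiveOfRecord F N θ.ν θ.τ9 (EOfRecord₁₃ F N θ.toStage13Params) (wOfRecord₉ F N θ.toStage9Params))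
    (hθ : θ.Admissible F N) (hκ : 0 ≤ θ.s2.lf.κ) (hE₀ : 0 ≤ θ.s2.lf.E₀) (hB₀ : 0 ≤ θ.s2.lf.B₀)
    {k : ℕ} (hk : k < p.K) (hM : 1 ≤ θ.τ9.M) (hS : SLaw₁₃CoPH F N θ p k)
    (s : SeqOfRecord F θ.ν θ.τ9.M (gOfRecord₁₃ F N θ.toStage13Params p) p.K (k + 1)) (hΩ : s.Ω (k + 1) = ∅)
    (hqloc : ∀ j, j < k → ∀ ω ω' : MultiCfg (F.P p.K) (SU N) (FluctV N), (∀ i, i ≤ k → ω i = ω' i) →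
      (θ.zhAt p s).quad j (s.init.Λ (j + 1)) ω = (θ.zhAt p s).quad j (s.init.Λ (j + 1)) ω')
    (hpre : ∀ j, j < k → (θ.zhAt p s).ζ0 j = (θ.zhAt p s.init).ζ0 j ∧ (θ.zhAt p s).quad j = (θ.zhAt p s.init).quad j)
    (hA : ∀ (t₀ : Sect2.TermValues (F.P p.K) (MatA N) (FluctV N) θ.τ9.M) (E₀ : ℝ) (S : ℕ → Set (Site (F.P p.K) 0))
      (a a' : Tk.MSFluct (F.P p.K) (FluctV N)) (Uf : GaugeField (F.P p.K) 0 (SU N)), (∀ i, i ≤ k → a i = a' i) →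
      (sect2ActionDataOfRecord F N (FluctV N) p.K (settingOfRecord₁₃ F N θ.toStage13Params p) (θ.rzAt p s.init) s.init t₀ (S, a) E₀).action23 k Uf =
        (sect2ActionDataOfRecord F N (FluctV N) p.K (settingOfRecord₁₃ F N θ.toStage13Params p) (θ.rzAt p s.init) s.init t₀ (S, a') E₀).action23 k Uf)
    (hZ : ∀ (V' : GaugeField (F.P p.K) (k + 1) (SU N)) (U₀ : GaugeField (F.P p.K) k (SU N)),
      (θ.zhAt p s).ζ0 k Set.univ (pairCfgAt (V := FluctV N) k V' U₀) =
        chiSeqOfRecord F N θ.ν θ.τ9.M (gOfRecord₁₃ F N θ.toStage13Params p) p.K k s.init U₀ *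
          wOfRecord₉ F N θ.toStage9Params p (gOfRecord₁₃ F N θ.toStage13Params p) k s U₀ ((avOfRecord F N p.K k).avg U₀))
    (hq : ∀ (V' : GaugeField (F.P p.K) (k + 1) (SU N)) (U₀ : GaugeField (F.P p.K) k (SU N)), (θ.zhAt p s).quad k ∅ (pairCfgAt (V := FluctV N) k V' U₀) = 0)
    {C : ℝ}
    (hmB : ∀ (t₀ : Sect2.TermValues (F.P p.K) (MatA N) (FluctV N) θ.τ9.M) (E₀ : ℝ),
      ∀ S ∈ admSOfRecord F θ.ν θ.τ9.M (gOfRecord₁₃ F N θ.toStage13Params p) p.K k s.init,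
      Measurable fun U₀ : GaugeField (F.P p.K) k (SU N) =>
        tkBranchOfRecord F N (FluctV N) θ.ν θ.τ9.M _ p.K (WtOfRecord₁₃H F N θ p s) s.init S k
          (fun ω => sect2Operand F N (FluctV N) p.K (settingOfRecord₁₃ F N θ.toStage13Params p) (θ.rzAt p s.init) s.init t₀ E₀
            (UbgOfRecord₁₃CoP F N θ.toStage13Params p k s.init) (S, fun j => (ω j).2) (fun j => (ω j).1))
          (baseCfg (V := FluctV N) k U₀))
    (hCB : ∀ (t₀ : Sect2.TermValues (F.P p.K) (MatA N) (FluctV N) θ.τ9.M) (E₀ : ℝ),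
      ∀ S ∈ admSOfRecord F θ.ν θ.τ9.M (gOfRecord₁₃ F N θ.toStage13Params p) p.K k s.init, ∀ U₀ : GaugeField (F.P p.K) k (SU N),
      |tkBranchOfRecord F N (FluctV N) θ.ν θ.τ9.M _ p.K (WtOfRecord₁₃H F N θ p s) s.init S k
          (fun ω => sect2Operand F N (FluctV N) p.K (settingOfRecord₁₃ F N θ.toStage13Params p) (θ.rzAt p s.init) s.init t₀ E₀
            (UbgOfRecord₁₃CoP F N θ.toStage13Params p k s.init) (S, fun j => (ω j).2) (fun j => (ω j).1))
          (baseCfg (V := FluctV N) k U₀)| ≤ C) :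
    ∃ (t₀ : Sect2.TermValues (F.P p.K) (MatA N) (FluctV N) θ.τ9.M) (E' : ℝ),
      Sect2.LawsRT (sect2TowerOfRecord F N (FluctV N) p.K (settingOfRecord₁₃ F N θ.toStage13Params p) (θ.rzAt p s) s t₀)
          (settingOfRecord₁₃ F N θ.toStage13Params p).lf (k + 1) ∧
        (slotsOfRecord F N θ.ν θ.τ9 (EOfRecord₁₃ F N θ.toStage13Params) (wOfRecord₉ F N θ.toStage9Params) θ.ppSel p
            (gOfRecord₁₃ F N θ.toStage13Params p) (k + 1) s = 0 ∨
          ∀ᵐ V' ∂fieldMeasure (F.P p.K) (k + 1) (SU N),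
            chiSeqOfRecord F N θ.ν θ.τ9.M (gOfRecord₁₃ F N θ.toStage13Params p) p.K (k + 1) s V' ≠ 0 →
              slotsOfRecord F N θ.ν θ.τ9 (EOfRecord₁₃ F N θ.toStage13Params) (wOfRecord₉ F N θ.toStage9Params) θ.ppSel p
                  (gOfRecord₁₃ F N θ.toStage13Params p) (k + 1) s V' =
                sect2Slot F N (FluctV N) p.K (settingOfRecord₁₃ F N θ.toStage13Params p) (θ.rzAt p s) (WtOfRecord₁₃H F N θ p s) s t₀ E'
                  (UbgOfRecord₁₃CoP F N θ.toStage13Params p (k + 1) s) V') := by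
  obtain ⟨t₀, E', hlaw, hcl⟩ := exists_lawsT_clause_succ_CoPH_of_Omega_empty_of_sLaw₁₃CoPH_of_oldBranch θ p h hk hM hE₀ hB₀ hS s hΩ hqloc hpre hA hZ hq hmB hCB
  exact ⟨t₀, E', hlaw.toRT_succ hθ.toStage12.pos.2.1 hκ hE₀ hB₀ (B16RLeafRecord13Live.gOfRecord₁₃_succ_nonneg F N θ.toStage13Params p k),
    slotClauseΦ_succ_of_slotTClauseΦ_of_liveSel_of_rstep F N θ.toStage13Params p (fun q j _ hj => h.rstep q j hj) hsel k hk s _ fun _ => hcl⟩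

end LawsOldBranch

end Summit.QuantumFields.YangMills.Theorems.BalabanUVNodesN11NoExpansionGeneralStepLawsCoPHOldBranch

end
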